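import Summits.FinalStateConjecture.FinalStateConjecture.Theorems.ZeroEnergyKerrOrBombErgoregionBombModTCollarLightPoints
import Literature.Geometry.Lorentzian.NonRotatingBlackHoleUniquenessProofs
import Literature.Geometry.Lorentzian.StationaryOrbitHorizontalFlow

/-!
# `ErgoregionBombModT` — Killing light points are transported along the stationary flow;
# the hovering species inhabits the antecedent (crux stmt-FinalStateConjecture-17838, lead c2)

Route `ZeroEnergyKerrOrBomb` of the Final State Conjecture, crux
`Summit.FinalStateConjecture.FinalStateConjecture.Theses.ZeroEnergyKerrOrBomb.ErgoregionBombModT`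
(the ergoregion bomb modulo the stationary flow), line `killing-light-points`: the crux is reduced
to the off-wall bomb plus `NoDocLightPoints` — no `p ∈ ⟨⟨M_ext⟩⟩` with `g(T,T)(p) = 0` and
`∇_T T = κ T` (p135563, p136504).  This file and its companion `…LightPointAntecedent.lean` show
that every such light point is itself an inhabitant of the crux's antecedent
`HasZeroEnergyRayTrappedModFlow`.  Here:

* `val_killing_self_of_isMIntegralCurve`, `leviCivita_killing_self_of_isMIntegralCurve` — `g(T,T)`
  and the light-point condition `∇_T T = κ T` are transported along the orbits of `T`: the flow
  maps are isometries fixing `T` (`StationaryAFBlackHole.exists_stationary_flow`,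
  `mfderiv_flow_apply_self`) and isometries fixing `T` preserve `∇T`
  (`PseudoRiemannianMetric.mfderiv_leviCivita_of_isometry`, O'Neill 1983, Ch. 3, Prop. 3.59);
* `isGeodesic_of_isMIntegralCurve_of_leviCivita_eq_zero` — a hovering light point (`κ = 0`) lies
  on a null geodesic orbit (geodesic on all of `ℝ`);
* `hasZeroEnergyRayTrappedModFlow_of_hoveringLightPoint` — hence the HOVERING species inhabits the
  antecedent with `S = {p}`, `s = univ` (the pointwise form of the cdisprove lemma
  `Negative.hasZeroEnergyRayTrappedModFlow_of_nullGeodesicOrbit`, p135428).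

References: B. O'Neill, *Semi-Riemannian geometry* (1983), Ch. 3 Prop. 3.18, 3.59, Ch. 9
Prop. 9.23–9.25; S. W. Hawking, G. F. R. Ellis (1973), §9.3 p. 331; A. D. Ionescu, S. Klainerman,
Surveys in Differential Geometry 20 (2015), §4; crux workfile
`Cruxes/ErgoregionBombModT/Lines/killing_light_points.lean` (skeleton v3).
-/

noncomputable section

open Bundle Set Filter Function
open scoped Manifold Topology ContDiff

-- summit = problem name (D-0017)
set_option linter.dupNamespace false

namespace Summit.FinalStateConjecture.FinalStateConjecture.Theorems.ErgoregionBombModT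

open Literature.Geometry.Lorentzian

section Invariance

variable {𝓑 : StationaryAFBlackHole.{0}} [𝓑.metric.HasLeviCivita]

/-- **`g(T,T)` is constant along the orbits of `T`** (the stationary Killing field; O'Neill 1983,
Ch. 9, Lemma 9.26 ff.: `X⟨X,X⟩ = 2⟨∇_X X, X⟩ = 0` for Killing `X`; tree lemma
`IsKillingField.val_self_apply_eq_of_isMIntegralCurve`). [cite: ONeill1983, Ch. 9, Prop. 9.25] -/
theorem val_killing_self_of_isMIntegralCurve {σ : ℝ → 𝓑.carrier}
    (hσ : IsMIntegralCurve σ 𝓑.killing) (t : ℝ) :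
    𝓑.metric.val (σ t) (𝓑.killing (σ t)) (𝓑.killing (σ t)) =
      𝓑.metric.val (σ 0) (𝓑.killing (σ 0)) (𝓑.killing (σ 0)) :=
  𝓑.isStationaryKilling.isKillingField.val_self_apply_eq_of_isMIntegralCurve hσ t 0

/-- **The light-point condition `∇_T T = κ T` is transported along the orbits of `T`.**  The flow
maps `φₜ` of the complete Killing field `T` (`StationaryAFBlackHole.exists_stationary_flow`) are
isometries with `dφₜ T = T ∘ φₜ` (`mfderiv_flow_apply_self`), hence preserve `∇T`
(`PseudoRiemannianMetric.mfderiv_leviCivita_of_isometry`, O'Neill 1983, Ch. 3, Prop. 3.59):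
`(∇_T T)(φₜ p) = dφₜ((∇_T T)(p)) = dφₜ(κ T_p) = κ T_{φₜ p}`; and every integral curve of `T` is a
flow line (`eq_flow_of_isMIntegralCurve`). [cite: ONeill1983, Ch. 3, Prop. 3.59] -/
theorem leviCivita_killing_self_of_isMIntegralCurve {σ : ℝ → 𝓑.carrier}
    (hσ : IsMIntegralCurve σ 𝓑.killing) {κ : ℝ}
    (h0 : 𝓑.metric.leviCivita 𝓑.killing (σ 0) (𝓑.killing (σ 0)) = κ • 𝓑.killing (σ 0)) (t : ℝ) :
    𝓑.metric.leviCivita 𝓑.killing (σ t) (𝓑.killing (σ t)) = κ • 𝓑.killing (σ t) := by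
  obtain ⟨θ, hθ, hθ0, hθadd, hθX, hiso, -⟩ := 𝓑.exists_stationary_flow
  have hK : 𝓑.metric.IsKillingField 𝓑.killing := 𝓑.isStationaryKilling.isKillingField
  have hθ2 : ContMDiff (𝓘(ℝ, ℝ).prod (𝓡 4)) (𝓡 4) 2 θ := hθ.of_le (WithTop.coe_le_coe.mpr le_top)
  have hK1 : ContMDiff (𝓡 4) (𝓡 4).tangent 1
      (fun x ↦ (⟨x, 𝓑.killing x⟩ : TangentBundle (𝓡 4) 𝓑.carrier)) :=
    hK.contMDiff.of_le (WithTop.coe_le_coe.mpr le_top)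
  -- `σ t = φₜ (σ 0)`
  have hflow : σ t = θ (t, σ 0) := eq_flow_of_isMIntegralCurve hK1 hθX hθ0 hσ t
  have hΦ : ContMDiff (𝓡 4) (𝓡 4) (∞ + 1) (fun q ↦ θ (t, q)) := by
    have h1 : ContMDiff (𝓡 4) (𝓡 4) ∞ (fun q ↦ θ (t, q)) :=
      hθ.comp (contMDiff_const.prodMk contMDiff_id)
    exact h1.of_le le_rfl
  have hΦ' : ∀ y, Function.Injective (mfderiv (𝓡 4) (𝓡 4) (fun q ↦ θ (t, q)) y) := fun y ↦
    Function.LeftInverse.injective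
      (g := mfderiv (𝓡 4) (𝓡 4) (fun q ↦ θ (-t, q)) (θ (t, y)))
      (PseudoRiemannianMetric.mfderiv_flow_neg_apply_mfderiv_flow hθ2 hθ0 hθadd t y)
  have hself := mfderiv_flow_apply_self hθ2 hθ0 hθadd hθX t
  have nat := 𝓑.metric.toPseudoRiemannianMetric.mfderiv_leviCivita_of_isometry hΦ hΦ' (hiso t)
    hK.mdifferentiableAt hself (σ 0) (𝓑.killing (σ 0))
  rw [hself] at nat
  rw [hflow, ← nat]
  change mfderiv (𝓡 4) (𝓡 4) (fun q ↦ θ (t, q)) (σ 0)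
      (𝓑.metric.leviCivita 𝓑.killing (σ 0) (𝓑.killing (σ 0))) = _
  rw [h0, map_smul, hself]

/-- The differentiability of `T` as a section of `TM` (it is `C^∞`). [folklore] -/
theorem mdifferentiableAt_killing (x : 𝓑.carrier) :
    MDifferentiableAt (𝓡 4) (𝓡 4).tangent
      (fun x ↦ (TotalSpace.mk' E4 x (𝓑.killing x) : TangentBundle (𝓡 4) 𝓑.carrier)) x :=
  𝓑.isStationaryKilling.isKillingField.mdifferentiableAt x

/-- **A hovering light point lies on a null geodesic orbit.** If `∇_T T = 0` at `σ 0` for an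
integral curve `σ` of `T`, then `σ` is a geodesic (on all of `ℝ`): its velocity field is `T ∘ σ`,
whose covariant derivative along `σ` is `∇_T T ∘ σ = 0` by transport of the light-point condition
(`leviCivita_killing_self_of_isMIntegralCurve` with `κ = 0`). O'Neill 1983, Ch. 3, Prop. 3.18 (3)
and Def. 3.19. [cite: ONeill1983, Ch. 3, Prop. 3.18] -/
theorem isGeodesic_of_isMIntegralCurve_of_leviCivita_eq_zero {σ : ℝ → 𝓑.carrier}
    (hσ : IsMIntegralCurve σ 𝓑.killing)
    (h0 : 𝓑.metric.leviCivita 𝓑.killing (σ 0) (𝓑.killing (σ 0)) = 0) :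
    IsGeodesic 𝓑.metric.toPseudoRiemannianMetric.leviCivita σ := by
  have hvel : (fun t ↦ velocity (𝓡 4) σ t) = fun t ↦ 𝓑.killing (σ t) :=
    funext fun t ↦ velocity_eq_of_isMIntegralCurve hσ t
  have hacc : ∀ t, 𝓑.metric.leviCivita 𝓑.killing (σ t) (𝓑.killing (σ t)) = 0 := fun t ↦ by
    have h := leviCivita_killing_self_of_isMIntegralCurve hσ (κ := 0) (by rw [h0, zero_smul]) t
    rwa [zero_smul] at h
  refine ⟨fun t _ ↦ ?_, fun t _ ↦ ?_⟩
  · have hlift : tangentLift (𝓡 4) σ = fun t ↦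
        (TotalSpace.mk' E4 (σ t) (𝓑.killing (σ t)) : TangentBundle (𝓡 4) 𝓑.carrier) := by
      funext t
      simp only [tangentLift, velocity_eq_of_isMIntegralCurve hσ t]
    rw [hlift]
    exact (mdifferentiableAt_killing (σ t)).comp t (hσ t).mdifferentiableAt
  · rw [hvel, covariantDerivAlong_comp_holds 𝓑.metric.toPseudoRiemannianMetric.leviCivita
      (hσ t).mdifferentiableAt (mdifferentiableAt_killing (σ t)), velocity_eq_of_isMIntegralCurve hσ t]
    exact hacc t

/-- **A hovering Killing light point of the d.o.c. inhabits the antecedent** (the complete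
species, `κ = 0`): the `T`-orbit `σ` through `p` is a geodesic on all of `ℝ`
(`isGeodesic_of_isMIntegralCurve_of_leviCivita_eq_zero`), hence a maximal null geodesic of zero
energy (`g(σ̇, σ̇) = g(σ̇, T) = g(T,T) = 0` along the orbit, `σ̇ = T ≠ 0` on the d.o.c.) inside the
orbit of `{p}`.  Companion of `Negative.hasZeroEnergyRayTrappedModFlow_of_nullGeodesicOrbit`
(cdisprove, p135428) with the geodesic hypothesis replaced by the POINTWISE light-point condition.
[cite: IonescuKlainerman2015, §4] -/
theorem hasZeroEnergyRayTrappedModFlow_of_hoveringLightPoint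
    (hT0 : ∀ p ∈ 𝓑.doc, 𝓑.killing p ≠ 0) {p : 𝓑.carrier} (hp : p ∈ 𝓑.doc)
    (hlam : 𝓑.metric.val p (𝓑.killing p) (𝓑.killing p) = 0)
    (hacc : 𝓑.metric.leviCivita 𝓑.killing p (𝓑.killing p) = 0) :
    𝓑.HasZeroEnergyRayTrappedModFlow := by
  obtain ⟨σ, hσ, hσ0⟩ := 𝓑.isStationaryKilling.isCompleteVectorField p
  subst hσ0
  have hdoc : ∀ τ, σ τ ∈ 𝓑.doc := fun τ ↦ StationaryAFBlackHole.mem_doc_of_isMIntegralCurve hσ hp τ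
  have hnull : ∀ τ, 𝓑.metric.val (σ τ) (𝓑.killing (σ τ)) (𝓑.killing (σ τ)) = 0 := fun τ ↦ by
    rw [val_killing_self_of_isMIntegralCurve hσ τ]
    exact hlam
  have hgeo := isGeodesic_of_isMIntegralCurve_of_leviCivita_eq_zero hσ hacc
  refine ⟨{σ 0}, isCompact_singleton, singleton_subset_iff.2 hp, σ, univ,
    IsGeodesic.isMaximalGeodesicOn_univ _ hgeo, univ_nonempty, fun t _ ↦ ?_, fun t _ ↦ ⟨σ, hσ, rfl, t, rfl⟩⟩
  rw [velocity_eq_of_isMIntegralCurve hσ t]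
  exact ⟨hnull t, hT0 _ (hdoc t), hnull t⟩

/-- **The hovering species inhabits the antecedent** — `hasZeroEnergyRayTrappedModFlow_of_hoveringLightPoint`
in closed `∀`-form (the registered sub-goal `hoveringLightPoint_inhabits_antecedent` of crux
stmt-FinalStateConjecture-17838: a certificate, not an obligation of the skeleton).
[cite: IonescuKlainerman2015, §4] -/
theorem hoveringLightPoint_inhabits_antecedent :
    ∀ (𝓑 : Literature.Geometry.Lorentzian.StationaryAFBlackHole.{0}) [𝓑.metric.HasLeviCivita], (∀ p ∈ 𝓑.doc, 𝓑.killing p ≠ 0) → ∀ p ∈ 𝓑.doc, 𝓑.metric.val p (𝓑.killing p) (𝓑.killing p) = 0 → 𝓑.metric.leviCivita 𝓑.killing p (𝓑.killing p) = 0 → 𝓑.HasZeroEnergyRayTrappedModFlow :=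
  fun _ _ hT0 _ hp hlam hacc ↦ hasZeroEnergyRayTrappedModFlow_of_hoveringLightPoint hT0 hp hlam hacc

end Invariance

end Summit.FinalStateConjecture.FinalStateConjecture.Theorems.ErgoregionBombModT

end
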